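import Summits.HodgeConjecture.HodgeConjecture.Theorems.SignSymmetricPowersMeridianOneNode
import Summits.HodgeConjecture.HodgeConjecture.Theorems.SignSymmetricPowersMeridianIrreducible
import HarnessLib

/-!
# K1-B meridian package VII — one-node centres with the same node lie on the same prime factor (route
# `SignSymmetricPowers`, item stmt-HodgeConjecture-19716)

Helper file (`--supports stmt-HodgeConjecture-19716`) for the open stub LINK (`stub_signConfluenceLinkG`) of the K1-B
line `andre-zariski` (and GEN): §3a of memo K1B-LINKF-PLAN-g23, "SAME COMPONENT for two one-node-at-`p` centres".

* `eval_eq_zero_of_forall_pderiv` (Euler); `exists_submodule_singularAt` — the linear space `N_p ⊆ ℂ^M` of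
  `M`-coefficient vectors whose form is singular at `p`, as a submodule;
* **`exists_common_factor_of_node_at`** — for `D_M = killHom Disc = w ∏ hⱼ` (`w` a unit; F-DISC-0's `Disc`,
  F-DISC-1 granted), two `M`-supported ONE-nodal forms `f₁, f₁'` with node at the SAME point `p` and pencil
  directions `g, g'` not vanishing at `p`: one index `j₀` is the unique factor through both `coeff_M f₁` and
  `coeff_M f₁'`, transversal to both pencils.  (`N_p` is irreducible — package VI,
  `exists_submodule_subset_zeroLocus` — and lies in `V(D_M)`, hence in one `V(h_{j₀})`; uniqueness at each centre
  is package I, `exists_unique_factor_pencil`.)  With packages II/IV this makes the given Π- (resp. L-) pencil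
  circle of LINK and the one-node circle of the symmetric-`A₃` confluence meridians of the SAME component, so that
  F-MC (`affineHypersurfaceComplement_meridian_isConj`) applies; the pair circles still need G2.

Sorry-free; axioms standard; no definition, no named fact.

## References

* [VoisinHodgeII2003] C. Voisin, Hodge Theory and Complex Algebraic Geometry II (CUP 2003), §2.1.1 Cor. 2.8.
* [Shimada2010ZvK] I. Shimada, Lectures on Zariski–van Kampen theorem (arXiv:0906.1074), §3 Prop. 3.4.
* [Hartshorne1977] R. Hartshorne, Algebraic Geometry, I Ex. 5.8, I Prop. 1.13.
-/

noncomputable section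

set_option linter.dupNamespace false

open MvPolynomial
open Literature.AlgebraicGeometry.Motives Literature.AlgebraicGeometry.Motives.UniversalHypersurface
open Literature.AlgebraicGeometry.HodgeTheory
open Summit.HodgeConjecture.HodgeConjecture.Theorems.SignSymmetricPowersMeridianOneNode
open Summit.HodgeConjecture.HodgeConjecture.Theorems.SignSymmetricPowersMeridianIrreducible

namespace Summit.HodgeConjecture.HodgeConjecture.Theorems.SignSymmetricPowersMeridianSameComponent

variable (n d : ℕ) (M : Set (DegIndex n d)) [DecidablePred (· ∈ M)]

/-- **Euler**: a form of degree `d ≥ 1` vanishes where all its partials vanish. [cite: Hartshorne1977, I Ex. 5.8] -/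
theorem eval_eq_zero_of_forall_pderiv {f : MvPolynomial (Fin (n + 2)) ℂ} (hf : f.IsHomogeneous d) (hd : 1 ≤ d)
    {p : Fin (n + 2) → ℂ} (hp : ∀ j, eval p (pderiv j f) = 0) : eval p f = 0 := by
  have hE := hf.sum_X_mul_pderiv
  have h1 : eval p (∑ i, X i * pderiv i f) = 0 := by
    rw [map_sum]
    exact Finset.sum_eq_zero fun i _ ↦ by rw [map_mul, hp i, mul_zero]
  rw [hE, map_nsmul, nsmul_eq_mul] at h1
  have hd' : ((d : ℕ) : ℂ) ≠ 0 := by exact_mod_cast (show d ≠ 0 by omega)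
  exact (mul_eq_zero.mp h1).resolve_left hd'

/-- The linear space `N_p ⊆ ℂ^M` of `M`-coefficient vectors whose form is singular at the point `p`
(all partials vanish at `p`), as a submodule. [cite: VoisinHodgeII2003, §2.1.1 Cor. 2.8] -/
theorem exists_submodule_singularAt (p : Fin (n + 2) → ℂ) :
    ∃ K : Submodule ℂ (M → ℂ), ∀ a : M → ℂ, a ∈ K ↔
      ∀ j, eval p (pderiv j (formOfCoeffs (fun m : DegIndex n d => if h : m ∈ M then a ⟨m, h⟩ else 0))) = 0 := by
  have hext_add : ∀ a b : M → ℂ, (fun m : DegIndex n d => if h : m ∈ M then (a + b) ⟨m, h⟩ else 0) =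
      (fun m : DegIndex n d => if h : m ∈ M then a ⟨m, h⟩ else 0) +
        (fun m : DegIndex n d => if h : m ∈ M then b ⟨m, h⟩ else 0) := fun a b => by
    funext m; by_cases hm : m ∈ M <;> simp [hm]
  have hext_smul : ∀ (c : ℂ) (a : M → ℂ), (fun m : DegIndex n d => if h : m ∈ M then (c • a) ⟨m, h⟩ else 0) =
      c • (fun m : DegIndex n d => if h : m ∈ M then a ⟨m, h⟩ else 0) := fun c a => by
    funext m; by_cases hm : m ∈ M <;> simp [hm]
  let S : Set (M → ℂ) := {a | ∀ j, eval p (pderiv j (formOfCoeffs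
      (fun m : DegIndex n d => if h : m ∈ M then a ⟨m, h⟩ else 0))) = 0}
  refine ⟨{ carrier := S, zero_mem' := ?zero, add_mem' := ?add, smul_mem' := ?smul }, fun a => Iff.rfl⟩
  case zero =>
    intro j
    have h0 : (fun m : DegIndex n d => if h : m ∈ M then (0 : M → ℂ) ⟨m, h⟩ else 0) = 0 := by
      funext m; by_cases hm : m ∈ M <;> simp [hm]
    have hf0 : formOfCoeffs (0 : DegIndex n d → ℂ) = 0 := by
      rw [formOfCoeffs_def]; simp
    rw [h0, hf0, map_zero, map_zero]
  case add =>
    intro a b ha hb j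
    have ha' := ha j
    have hb' := hb j
    rw [hext_add, formOfCoeffs_add, map_add, map_add, ha', hb', add_zero]
  case smul =>
    intro c a ha j
    have ha' := ha j
    rw [hext_smul, formOfCoeffs_smul, Derivation.map_smul, smul_eval, ha', mul_zero]

/-- **One-node centres with the SAME node lie on the same prime factor of the restricted discriminant, each
transversally.**  Setting of packages I/II: `Disc` an equation of the discriminant (F-DISC-0), `D_M = killHom Disc =
w · ∏ⱼ hⱼ` with `w` a unit (prime factorisation), F-DISC-1 granted.  If `f₁, f₁'` are `M`-supported forms of degree
`d` each with exactly one node, at the same point `p`, and `g, g'` are `M`-supported with `g(p), g'(p) ≠ 0`, then ONE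
index `j₀` serves both: `h_{j₀}` is the unique factor vanishing at `coeff_M f₁` and at `coeff_M f₁'`, and both
pencil directions are transversal.  (The linear space `N_p` of `M`-forms singular at `p` is irreducible and lies in
`V(D_M) = ⋃ V(hⱼ)`, hence in one `V(h_{j₀})` — package VI; uniqueness at each centre — package I.)  This is the
"same component" input of F-MC (`affineHypersurfaceComplement_meridian_isConj`) for the Π- and L-type conjugacies
of LINK-G. [cite: VoisinHodgeII2003, §2.1.1 Cor. 2.8] [cite: Shimada2010ZvK, §3 Prop. 3.4] -/
theorem exists_common_factor_of_node_at (hB : discriminant_localBranches_nodal)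
    {Disc : MvPolynomial (DegIndex n d) ℂ} (hirr : Irreducible Disc)
    (hV : ∀ a : DegIndex n d → ℂ, a ∈ singularCoeffs n d ↔ MvPolynomial.eval a Disc = 0) (hd : 1 ≤ d)
    {m : ℕ} {w : MvPolynomial M ℂ} (hw : IsUnit w) (h : Fin m → MvPolynomial M ℂ)
    (hfac : killHom ℂ n d M Disc = w * ∏ j, h j)
    {f₁ g f₁' g' : MvPolynomial (Fin (n + 2)) ℂ} (hf₁ : f₁.IsHomogeneous d) (hg : g.IsHomogeneous d)
    (hf₁' : f₁'.IsHomogeneous d) (hg' : g'.IsHomogeneous d)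
    (hM₁ : IsSupportedOn n d M f₁) (hMg : IsSupportedOn n d M g)
    (hM₁' : IsSupportedOn n d M f₁') (hMg' : IsSupportedOn n d M g') {p : Fin (n + 2) → ℂ}
    (hnod : IsNodalFormWithNodes f₁ ![p]) (hnod' : IsNodalFormWithNodes f₁' ![p])
    (hgp : MvPolynomial.eval p g ≠ 0) (hgp' : MvPolynomial.eval p g' ≠ 0) :
    haveI : Fintype M := Subtype.fintype _
    ∃ j₀, (MvPolynomial.eval (fun m' : M => coeff m'.1.1 f₁) (h j₀) = 0 ∧
        (∀ i, i ≠ j₀ → MvPolynomial.eval (fun m' : M => coeff m'.1.1 f₁) (h i) ≠ 0) ∧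
        ∑ k, MvPolynomial.eval (fun m' : M => coeff m'.1.1 f₁) (pderiv k (h j₀)) * (fun m' : M => coeff m'.1.1 g) k ≠ 0) ∧
      (MvPolynomial.eval (fun m' : M => coeff m'.1.1 f₁') (h j₀) = 0 ∧
        (∀ i, i ≠ j₀ → MvPolynomial.eval (fun m' : M => coeff m'.1.1 f₁') (h i) ≠ 0) ∧
        ∑ k, MvPolynomial.eval (fun m' : M => coeff m'.1.1 f₁') (pderiv k (h j₀)) * (fun m' : M => coeff m'.1.1 g') k ≠ 0) := by
  classical
  haveI : Fintype M := Subtype.fintype _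
  have hwne : ∀ a : M → ℂ, MvPolynomial.eval a w ≠ 0 := fun a => (hw.map (MvPolynomial.eval a)).ne_zero
  obtain ⟨j, hj, hjne, hjtr⟩ := exists_unique_factor_pencil n d M hB hirr hV hd w h hfac hf₁ hg hM₁ hMg hnod hgp (hwne _)
  obtain ⟨j', hj', hjne', hjtr'⟩ :=
    exists_unique_factor_pencil n d M hB hirr hV hd w h hfac hf₁' hg' hM₁' hMg' hnod' hgp' (hwne _)
  -- the linear space `N_p` lies in one `V(h_{j₀})`
  obtain ⟨K, hK⟩ := exists_submodule_singularAt n d M p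
  have hp0 : p ≠ 0 := (hnod.1 0).ne_zero
  have hKsub : ∀ a ∈ (K : Set (M → ℂ)), ∃ j, MvPolynomial.aeval a (h j) = 0 := by
    intro a ha
    have hpart := (hK a).1 ha
    set F := formOfCoeffs (fun m : DegIndex n d => if h : m ∈ M then a ⟨m, h⟩ else 0) with hF
    have hsing : (fun m : DegIndex n d => if h : m ∈ M then a ⟨m, h⟩ else 0) ∈ singularCoeffs n d := by
      rw [mem_singularCoeffs_iff]
      intro hns
      obtain ⟨j, hj⟩ := hns.exists_eval_pderiv_ne_zero hp0
        (eval_eq_zero_of_forall_pderiv n d (isHomogeneous_formOfCoeffs _) hd hpart)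
      exact hj (hpart j)
    have hDM : MvPolynomial.eval a (killHom ℂ n d M Disc) = 0 := by
      rw [eval_killHom, ← hV]; exact hsing
    rw [hfac, map_mul, mul_eq_zero, map_prod, Finset.prod_eq_zero_iff] at hDM
    rcases hDM with hw0 | ⟨j, -, hj⟩
    · exact absurd hw0 (hwne a)
    · exact ⟨j, hj⟩
  obtain ⟨j₀, hj₀⟩ := exists_submodule_subset_zeroLocus K h hKsub
  -- both centres lie in `N_p`
  have hmem : ∀ {f : MvPolynomial (Fin (n + 2)) ℂ}, f.IsHomogeneous d → IsSupportedOn n d M f →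
      IsNodalFormWithNodes f ![p] → (fun m' : M => coeff m'.1.1 f) ∈ (K : Set (M → ℂ)) := by
    intro f hf hMf hnodf
    show (fun m' : M => coeff m'.1.1 f) ∈ K
    rw [hK]
    intro j
    rw [extend_coeffM_eq_coeffsOf n d M hMf, formOfCoeffs_coeffsOf n d hf]
    exact (hnodf.1 0).eval_pderiv j
  have h1 : MvPolynomial.eval (fun m' : M => coeff m'.1.1 f₁) (h j₀) = 0 := hj₀ _ (hmem hf₁ hM₁ hnod)
  have h1' : MvPolynomial.eval (fun m' : M => coeff m'.1.1 f₁') (h j₀) = 0 := hj₀ _ (hmem hf₁' hM₁' hnod')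
  have hjj₀ : j = j₀ := by
    by_contra hne
    exact hjne j₀ (fun h => hne h.symm) h1
  have hj'j₀ : j' = j₀ := by
    by_contra hne
    exact hjne' j₀ (fun h => hne h.symm) h1'
  refine ⟨j₀, ⟨h1, fun i hi => ?_, ?_⟩, ⟨h1', fun i hi => ?_, ?_⟩⟩
  · exact hjne i (fun h => hi (h.trans hjj₀))
  · rw [← hjj₀]; exact hjtr
  · exact hjne' i (fun h => hi (h.trans hj'j₀))
  · rw [← hj'j₀]; exact hjtr'

end Summit.HodgeConjecture.HodgeConjecture.Theorems.SignSymmetricPowersMeridianSameComponent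

end
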